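import Summits.FinalStateConjecture.FinalStateConjecture.Theorems.EIHFluxBalanceInertialRecessionStubRechart3BoostTransport
import Summits.FinalStateConjecture.FinalStateConjecture.Theorems.EIHFluxBalanceInertialRecessionHoleLateChart

/-!
# Route EIHFluxBalance — `InertialRecession`, re-charting: the boosted clock charts are late charts into the exterior region

Helper file for the crux `stmt-FinalStateConjecture-10166`
(`Summit.FinalStateConjecture.FinalStateConjecture.Theses.EIHFluxBalance.InertialRecession`),
line `sublinear-is-free-clean-window-charges`, stub `stub_rechart` (the transfer P2), field
`isLateChart` of the sought `FinalStateDecomposition`.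

`isLateChart_boostChart` — for a re-charting map `A` with the clauses exported by `clockChart_package`
(smooth open embedding of `E4`, `τ₀ < (A y)⁰`, `A y ∈ U` and all painted radii `> r₊ⱼ` on the rest
exterior) and the crux hypotheses on the lab chart `Φ` (smooth, open embedding of the late region,
painted late exterior mapped into `O`), the BOOSTED chart `boostChart Λ M a (Φ ∘ A)` is a late chart
into `O` after every model time (`…HoleLateChart` with the open embedding `A ∘ Λ⁻¹` of `E4`). [folklore]
-/

noncomputable section

set_option linter.dupNamespace false

open Set Filter Function Metric Topology TopologicalSpace
open scoped ContDiff Manifold ENNReal BigOperators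
open Literature.Geometry.Lorentzian

namespace Summit.FinalStateConjecture.FinalStateConjecture.Theorems.SublinearIsFree.Rechart

/-- **The boosted clock chart is a late chart into the exterior region.** [folklore] -/
theorem isLateChart_boostChart (𝓢 : Spacetime 4) {N : ℕ} (i : Fin N) (M a : Fin N → ℝ)
    (Λp : Fin N → ℝ → lorentzGroup) (ξ : Fin N → ℝ → E3) (U : Opens E4) (Φ : U → 𝓢.carrier)
    (hΦ : ContMDiff 𝓘(ℝ, E4) (𝓡 4) ∞ Φ) {τ₀ : ℝ}
    (hemb : Topology.IsOpenEmbedding (((⟨U, fun x ↦ Minkowski.bilin +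
      ∑ j, (boostedKerrBilin (Λp j (x 0)) (E4.ofTimeSpace (x 0) (ξ j (x 0))) (M j) (a j) x -
        Minkowski.bilin), fun x ↦ x 0, E4.spatialNorm⟩ : ModelBackground).lateRegion τ₀).restrict Φ))
    {O : Set 𝓢.carrier}
    (hO : Φ '' {x : U | τ₀ < x.1 0 ∧ ∀ j, Kerr.rPlus (M j) (a j) < Kerr.radius (a j)
      (poincareInv (Λp j (x.1 0)) (E4.ofTimeSpace (x.1 0) (ξ j (x.1 0))) x.1)} ⊆ O)
    (Λ : lorentzGroup) {A : E4 → E4} (hAc : ContDiff ℝ ∞ A) (hAe : Topology.IsOpenEmbedding A)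
    (hAU : ∀ y ∈ boostedKerrExterior 1 0 (M i) (a i), A y ∈ U) (hlate : ∀ y, τ₀ < A y 0)
    (hradii : ∀ y ∈ boostedKerrExterior 1 0 (M i) (a i), ∀ j, Kerr.rPlus (M j) (a j) <
      Kerr.radius (a j) (poincareInv (Λp j (A y 0)) (E4.ofTimeSpace (A y 0) (ξ j (A y 0))) (A y)))
    (τ₁ : ℝ) :
    𝓢.IsLateChart (boostedKerrBackground Λ 0 (M i) (a i)) O τ₁
      (boostChart Λ (M i) (a i) (fun y ↦ Φ ⟨A y.1, hAU y.1 y.2⟩)) := by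
  set Bf : ModelBackground := ⟨U, fun x ↦ Minkowski.bilin +
      ∑ j, (boostedKerrBilin (Λp j (x 0)) (E4.ofTimeSpace (x 0) (ξ j (x 0))) (M j) (a j) x -
        Minkowski.bilin), fun x ↦ x 0, E4.spatialNorm⟩ with hBf
  -- the re-charting map of the boosted chart, an open embedding of `E4`
  set A' : E4 → E4 := fun x ↦ A ((Λ : E4 ≃L[ℝ] E4).symm x) with hA'
  have hA'c : ContDiff ℝ ∞ A' := hAc.comp (Λ : E4 ≃L[ℝ] E4).symm.contDiff
  have hA'e : Topology.IsOpenEmbedding A' := hAe.comp (Λ : E4 ≃L[ℝ] E4).symm.toHomeomorph.isOpenEmbedding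
  have hA'U : ∀ x ∈ (boostedKerrBackground Λ 0 (M i) (a i)).domain, A' x ∈ Bf.domain := fun x hx ↦
    hAU _ (symm_mem_boostedKerrExterior_one Λ (M i) (a i) hx)
  have hψ : ∀ x : (boostedKerrBackground Λ 0 (M i) (a i)).domain,
      boostChart Λ (M i) (a i) (fun y ↦ Φ ⟨A y.1, hAU y.1 y.2⟩) x = Φ ⟨A' x.1, hA'U x.1 x.2⟩ := fun x ↦ rfl
  refine ⟨?_, ?_, ?_⟩
  · exact contMDiff_comp_smooth (Ω := boostedKerrExterior Λ 0 (M i) (a i)) (U := U) hA'c hA'U hψ hΦ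
  · refine isOpenEmbedding_restrict_comp_of_isOpenEmbedding' (M := 𝓢.carrier) Bf (boostedKerrBackground Λ 0 (M i) (a i))
      (fun _ ↦ rfl) hemb hA'e hA'U (fun x hx ↦ hlate _) hψ ?_
    -- the late region is open
    have hc : Continuous fun x : (boostedKerrBackground Λ 0 (M i) (a i)).domain ↦
        (boostedKerrBackground Λ 0 (M i) (a i)).time x.1 := by
      have h1 : Continuous fun x : E4 ↦ (poincareInv Λ 0 x) 0 :=
        (PiLp.continuous_apply 2 _ 0).comp (continuous_poincareInv Λ 0)
      exact h1.comp continuous_subtype_val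
    exact isOpen_lt continuous_const hc
  · rintro _ ⟨x, hx, rfl⟩
    rw [hψ]
    refine hO ⟨⟨A' x.1, hA'U x.1 x.2⟩, ⟨hlate _, fun j ↦ ?_⟩, rfl⟩
    exact hradii _ (symm_mem_boostedKerrExterior_one Λ (M i) (a i) x.2) j

/-- Registered one-line form (worker carrier `rechart_continuous_boosted_time`): the boosted model time is continuous. [folklore] -/
theorem rechart_continuous_boosted_time : open Literature.Geometry.Lorentzian in ∀ (Λ : lorentzGroup), Continuous fun x : E4 ↦ (poincareInv Λ 0 x) 0 :=
  fun Λ ↦ (PiLp.continuous_apply 2 _ 0).comp (continuous_poincareInv Λ 0)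

end Summit.FinalStateConjecture.FinalStateConjecture.Theorems.SublinearIsFree.Rechart

end
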